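import Mathlib
import HarnessLib
import Summits.Ventures.LatticeQCDFlow.Exactness.FlowPushforward
import Summits.Ventures.LatticeQCDFlow.Exactness.IMHKernel

/-!
# The flow-based MCMC sampler on a general state space samples the target exactly

HONEST FRAMING: exact (Metropolis-corrected) sampling algorithms for lattice gauge theory;
figures of merit are autocorrelation/cost numbers at stated couplings and volumes; no
continuum-physics claim.

Venture `LatticeQCDFlow` (cell pub-lqcd), topic `Exactness`, FANOUT row 30 (lean-1).  This short
file COMPOSES `FlowPushforward.lean` (E3: the model law of a flow with exact Jacobian has density
`q̃ = (r/J) ∘ F⁻¹`) with `IMHKernel.lean` (E1 on general spaces: the independence Metropolis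
kernel with weights `w = dπ/dq` is `π`-reversible) into the end-to-end statement for the sampler
of Albergo–Kanwar–Shanahan 2019 / Kanwar et al. 2020 (named only; nothing cited as a fact):

* `target_eq_model_withDensity` — with densities against the reference volume, target `p · vol`
  and model `q̃ · vol` (`q̃ > 0`), the target is the model reweighted by the computable ratio
  `w = p/q̃`: `p · vol = (p/q̃) · (q̃ · vol)`;
* `flow_model_law` — the model law `q̃ · vol` IS the push-forward of the prior of density
  `(q̃ ∘ F) · J` through the flow (so `w(x) = p(x) J(z) / r(z)` at `x = F z` is what the code
  evaluates);
* `flowMCMC_isReversible`, `flowMCMC_invariant` — the chain "propose `x' = F(z')`, `z' ∼ prior`;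
  accept with `min {1, w(x')/w(x)}`" is reversible for, and leaves invariant, the target
  `p · vol` — for EVERY flow with exact Jacobian and everywhere-positive model density.  On
  `Ω = G^E` with `vol = ⊗ Haar` and `p = e^{−β S_W}` this is the exactness of gauge-equivariant
  flow-MCMC; what the flow's quality controls is only the rejection mass (`IMHKernel.lean`) and,
  on finite discretisations, the mixing/sticking bounds of `FlowMCMC.lean`.
-/

namespace Summit.Ventures.LatticeQCDFlow.Exactness

open MeasureTheory ProbabilityTheory
open scoped ENNReal

variable {Ω : Type*} [MeasurableSpace Ω] {vol : Measure Ω} {p q : Ω → ℝ}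

/-- Target = model reweighted by `w = p/q̃` (real densities against `vol`, `q̃ > 0`). -/
theorem target_eq_model_withDensity (hp : Measurable p) (hq : Measurable q)
    (hq0 : ∀ x, 0 < q x) :
    (vol.withDensity fun x => ENNReal.ofReal (q x)).withDensity
        (fun x => ENNReal.ofReal (p x / q x)) =
      vol.withDensity fun x => ENNReal.ofReal (p x) := by
  have hrw : (fun x => ENNReal.ofReal (p x / q x)) =
      fun x => ENNReal.ofReal (p x) / ENNReal.ofReal (q x) := by
    funext x
    exact ENNReal.ofReal_div_of_pos (hq0 x)
  rw [hrw]
  exact withDensity_reweight vol hp.ennreal_ofReal hq.ennreal_ofReal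
    (fun x => (ENNReal.ofReal_pos.mpr (hq0 x)).ne') (fun x => ENNReal.ofReal_ne_top)

/-- The model law `q̃ · vol` is the push-forward through the flow `F` (exact Jacobian `J`) of the
prior with density `(q̃ ∘ F) · J` — i.e. `q̃(F z) = r(z)/J(z)` is computable along the flow. -/
theorem flow_model_law {F : Ω → Ω} {J : Ω → ℝ≥0∞} (h : HasJacobian vol F J) (hq : Measurable q) :
    Measure.map F (vol.withDensity fun z => ENNReal.ofReal (q (F z)) * J z) =
      vol.withDensity fun x => ENNReal.ofReal (q x) :=
  h.map_withDensity (q := fun x => ENNReal.ofReal (q x)) hq.ennreal_ofReal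

/-- **Flow-based MCMC is reversible for the target** `p · vol`: model law `q̃ · vol` (a
probability measure, `q̃ > 0`), weights `w = p/q̃` (`p > 0`). -/
theorem flowMCMC_isReversible (hp : Measurable p) (hq : Measurable q) (hp0 : ∀ x, 0 < p x)
    (hq0 : ∀ x, 0 < q x) [IsProbabilityMeasure (vol.withDensity fun x => ENNReal.ofReal (q x))] :
    Kernel.IsReversible
      (indepMH (vol.withDensity fun x => ENNReal.ofReal (q x)) fun x => p x / q x)
      (vol.withDensity fun x => ENNReal.ofReal (p x)) := by
  rw [← target_eq_model_withDensity hp hq hq0]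
  exact indepMH_isReversible (hp.div hq) fun x => div_pos (hp0 x) (hq0 x)

/-- **Flow-based MCMC samples the target exactly**: `p · vol` is invariant under the chain
"propose from the flow model, accept with `min {1, w(x')/w(x)}`, `w = p/q̃`", for every flow model
with everywhere-positive density — the end-to-end exactness statement (E1 ∘ E3). -/
theorem flowMCMC_invariant (hp : Measurable p) (hq : Measurable q) (hp0 : ∀ x, 0 < p x)
    (hq0 : ∀ x, 0 < q x) [IsProbabilityMeasure (vol.withDensity fun x => ENNReal.ofReal (q x))] :
    Kernel.Invariant
      (indepMH (vol.withDensity fun x => ENNReal.ofReal (q x)) fun x => p x / q x)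
      (vol.withDensity fun x => ENNReal.ofReal (p x)) := by
  rw [← target_eq_model_withDensity hp hq hq0]
  exact indepMH_invariant (hp.div hq) fun x => div_pos (hp0 x) (hq0 x)

end Summit.Ventures.LatticeQCDFlow.Exactness
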